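import Mathlib
import HarnessLib
import Summits.ValiantsHypothesis.ValiantsHypothesis.Theorems.LacunarySymmetroidMatrixDescartesProductPlusOneFewPullers

/-!
# ValiantsHypothesis / LacunarySymmetroid — crux `MatrixDescartes` (stmt-ValiantsHypothesis-18050, V1),
# LINE (A) «product_plus_one», floor `OneChangeFloorK3`: the RISER-MASS LAW (collective form of the few-pullers law, every ratio)

Refinement of ✓ `…ProductPlusOneFewPullers`.  There the risers' Euler ratios were bounded by `x^p·Ψ_j > p` only.  In fact a switched incoherent
row satisfies `x^p·Ψ_j > μ_j(x) := (p·b_j + q·c_j·Z)/(b_j + c_j·Z)` (`Z = x^{q−p}`; the `a`-free LETTER MEAN of `p` and `q` with weights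
`|b_j|x^p`, `|c_j|x^q`; `μ_j ↑ q` as the riser ages), so the down-crossing estimate becomes COLLECTIVE:

* ★★ `psi_deriv_neg_at_zero_of_riserMass` — pure incoherent company, at a zero of `Ψ`: if `(q−p)·|R|·|U| ≤ m·Σ_{j∈R} μ_j(x)` (`R` = switched,
  `U` = unswitched rows at `x`) then `Ψ′(x) < 0`.  Since `μ_j > p` this contains the few-pullers law; since `μ_j → q` OLD risers pay for YOUNG ones:
  a window with young risers inside their balance zones is still wiggle-free when the risers' mean letter weight is large enough;
* ★★ `euler_window_roots_le_one_of_riserMass` — the window law in the line's currency: on a zero-free window `[u,v] ⊂ (0,∞)` of a pure incoherent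
  company on ANY support with the riser-mass inequality at every point, `eulerNumerator d a 0` has at most ONE root.

HONEST FRAMING: a cell of the research floor; NOT `OneChangeFloorK3` / the stubs / `MatrixDescartes`; `VP ≠ VNP` is NOT proved.
No definitions, no named facts; Mathlib + the lane files.
-/

set_option linter.dupNamespace false

namespace Summit.ValiantsHypothesis.ValiantsHypothesis.Theorems.LacunarySymmetroidMatrixDescartes

namespace ProductPlusOne

open Polynomial Finset
open scoped BigOperators

/-- **A riser's Euler ratio exceeds its letter mean:** incoherent no-dip row (`a b < 0`, `a c < 0`), switched (`a·g(x) < 0`), `x > 0` ⇒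
`(p b + q c Z)/(b + c Z) < x^{e+1}·Ψ_j` (`Z = x^{k+1}`), and the letter mean is `> p`. [this file's lemma] -/
theorem riser_letterMean_lt (a b c : ℝ) (e k : ℕ) {x : ℝ} (hx : 0 < x) (hab : a * b < 0) (hac : a * c < 0)
    (hsw : a * (a + b * x ^ (e + 1) + c * x ^ (e + k + 2)) < 0) :
    (e + 1 : ℝ) < ((e + 1 : ℝ) * b + (e + k + 2 : ℝ) * c * x ^ (k + 1)) / (b + c * x ^ (k + 1)) ∧
    ((e + 1 : ℝ) * b + (e + k + 2 : ℝ) * c * x ^ (k + 1)) / (b + c * x ^ (k + 1))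
      < x ^ (e + 1) * (((e + 1 : ℝ) * b + (e + k + 2 : ℝ) * c * x ^ (k + 1)) / (a + b * x ^ (e + 1) + c * x ^ (e + k + 2))) := by
  set g := a + b * x ^ (e + 1) + c * x ^ (e + k + 2) with hgdef
  set N := (e + 1 : ℝ) * b + (e + k + 2 : ℝ) * c * x ^ (k + 1) with hNdef
  have hZ : 0 < x ^ (k + 1) := pow_pos hx _
  have hX : 0 < x ^ (e + 1) := pow_pos hx _
  have hXZ : x ^ (e + 1) * x ^ (k + 1) = x ^ (e + k + 2) := by rw [← pow_add]; ring_nf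
  have hk1 : (0 : ℝ) < (k : ℝ) + 1 := by positivity
  rcases lt_or_gt_of_ne (show a ≠ 0 by rintro rfl; rw [zero_mul] at hac; exact lt_irrefl 0 hac) with ha | ha
  · -- a < 0 < b, c ; g > 0
    have hb : 0 < b := by nlinarith
    have hc : 0 < c := by nlinarith
    have hg : 0 < g := by nlinarith
    have hden : 0 < b + c * x ^ (k + 1) := by positivity
    refine ⟨?_, ?_⟩
    · rw [lt_div_iff₀ hden, hNdef]
      have : 0 < ((k : ℝ) + 1) * c * x ^ (k + 1) := by positivity
      nlinarith
    · -- `N/(b + cZ) < X N / g` ⟺ `g < X (b + cZ)` (N > 0) ⟺ `a < 0`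
      have hN : 0 < N := by rw [hNdef]; positivity
      rw [mul_div_assoc', div_lt_div_iff₀ hden hg]
      have e1 : x ^ (e + 1) * N * (b + c * x ^ (k + 1)) - N * g = N * (-a) := by
        rw [hgdef, ← hXZ]; ring
      nlinarith [mul_pos hN (neg_pos.mpr ha)]
  · -- a > 0 > b, c ; g < 0
    have hb : b < 0 := by nlinarith
    have hc : c < 0 := by nlinarith
    have hg : g < 0 := by nlinarith
    have hden : b + c * x ^ (k + 1) < 0 := by nlinarith [mul_neg_of_neg_of_pos hc hZ]
    refine ⟨?_, ?_⟩
    · rw [lt_div_iff_of_neg hden, hNdef]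
      have : ((k : ℝ) + 1) * c * x ^ (k + 1) < 0 := mul_neg_of_neg_of_pos (mul_neg_of_pos_of_neg hk1 hc) hZ
      nlinarith
    · have hN : N < 0 := by
        rw [hNdef]
        have h1 : (e + k + 2 : ℝ) * c * x ^ (k + 1) < 0 := mul_neg_of_neg_of_pos (mul_neg_of_pos_of_neg (by positivity) hc) hZ
        have h2 : (e + 1 : ℝ) * b < 0 := mul_neg_of_pos_of_neg (by positivity) hb
        linarith
      have e2 : N / (b + c * x ^ (k + 1)) = (-N) / (-(b + c * x ^ (k + 1))) := by rw [neg_div_neg_eq]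
      have e3 : x ^ (e + 1) * (N / g) = (-(x ^ (e + 1) * N)) / (-g) := by rw [neg_div_neg_eq, mul_div_assoc']
      rw [e2, e3, div_lt_div_iff₀ (neg_pos.mpr hden) (neg_pos.mpr hg)]
      have e1 : (-(x ^ (e + 1) * N)) * (-(b + c * x ^ (k + 1))) - (-N) * (-g) = (-N) * a := by
        rw [hgdef, ← hXZ]; ring
      nlinarith [mul_pos (neg_pos.mpr hN) ha]

/-- ★★ **RISER MASS ⇒ DOWN-CROSSING.**  Pure incoherent no-dip company (`a_j b_j < 0`, `a_j c_j < 0`), `m ≥ 1`, `x > 0`, no row vanishing at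
`x`, `Ψ(x) = 0`, and, with `R`/`U` the switched/unswitched rows at `x` and `μ_j = (p b_j + q c_j Z)/(b_j + c_j Z)`,
`(k+1)·|R|·|U| ≤ m·Σ_{j∈R} μ_j(x)`.  Then `Ψ′(x) < 0`. [this file's theorem] -/
theorem psi_deriv_neg_at_zero_of_riserMass {m : ℕ} (hm : 0 < m) (a b c : Fin m → ℝ) (e k : ℕ) {x : ℝ} (hx : 0 < x)
    (hg : ∀ j, a j + b j * x ^ (e + 1) + c j * x ^ (e + k + 2) ≠ 0)
    (hinc : ∀ j, a j * b j < 0 ∧ a j * c j < 0)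
    (hmass : ((k : ℝ) + 1)
        * ((Finset.univ.filter (fun j => a j * (a j + b j * x ^ (e + 1) + c j * x ^ (e + k + 2)) < 0)).card : ℝ)
        * ((Finset.univ.filter (fun j => 0 < a j * (a j + b j * x ^ (e + 1) + c j * x ^ (e + k + 2)))).card : ℝ)
      ≤ (m : ℝ) * ∑ j ∈ Finset.univ.filter (fun j => a j * (a j + b j * x ^ (e + 1) + c j * x ^ (e + k + 2)) < 0),
          ((e + 1 : ℝ) * b j + (e + k + 2 : ℝ) * c j * x ^ (k + 1)) / (b j + c j * x ^ (k + 1)))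
    (hzero : (∑ j, ((e + 1 : ℝ) * b j + (e + k + 2 : ℝ) * c j * x ^ (k + 1)) / (a j + b j * x ^ (e + 1) + c j * x ^ (e + k + 2))) = 0) :
    (∑ j, ((((e + k + 2 : ℝ) * c j * ((k + 1 : ℝ) * x ^ k)) * (a j + b j * x ^ (e + 1) + c j * x ^ (e + k + 2))
        - ((e + 1 : ℝ) * b j + (e + k + 2 : ℝ) * c j * x ^ (k + 1))
          * (b j * ((e + 1 : ℝ) * x ^ e) + c j * ((e + k + 2 : ℝ) * x ^ (e + k + 1))))
        / (a j + b j * x ^ (e + 1) + c j * x ^ (e + k + 2)) ^ 2)) < 0 := by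
  classical
  set G : Fin m → ℝ := fun j => a j + b j * x ^ (e + 1) + c j * x ^ (e + k + 2) with hG
  set ψ : Fin m → ℝ := fun j => ((e + 1 : ℝ) * b j + (e + k + 2 : ℝ) * c j * x ^ (k + 1)) / G j with hψ
  set μ : Fin m → ℝ := fun j => ((e + 1 : ℝ) * b j + (e + k + 2 : ℝ) * c j * x ^ (k + 1)) / (b j + c j * x ^ (k + 1)) with hμ
  set U := Finset.univ.filter (fun j => 0 < a j * G j) with hU
  set R := Finset.univ.filter (fun j => a j * G j < 0) with hR
  have hZ : 0 < x ^ (k + 1) := pow_pos hx _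
  have hX : 0 < x ^ (e + 1) := pow_pos hx _
  have hq : (0 : ℝ) < (e + k + 2 : ℝ) := by positivity
  have hane : ∀ j, a j * G j ≠ 0 := fun j => mul_ne_zero (by
      intro h0; have := (hinc j).2; rw [h0, zero_mul] at this; exact lt_irrefl 0 this) (hg j)
  have hRsw : ∀ j ∈ R, a j * G j < 0 := fun j hj => by rw [hR, mem_filter] at hj; exact hj.2
  have hUun : ∀ j ∈ U, 0 < a j * G j := fun j hj => by rw [hU, mem_filter] at hj; exact hj.2
  have hRfacts : ∀ j ∈ R, 0 < ψ j ∧ c j / G j ≤ ψ j / ((e + k + 2 : ℝ) * x ^ (k + 1)) ∧ (e + 1 : ℝ) < x ^ (e + 1) * ψ j :=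
    fun j hj => riser_facts (a j) (b j) (c j) e k hx (hinc j).1 (hinc j).2 (hRsw j hj)
  have hRmass : ∀ j ∈ R, μ j < x ^ (e + 1) * ψ j :=
    fun j hj => (riser_letterMean_lt (a j) (b j) (c j) e k hx (hinc j).1 (hinc j).2 (hRsw j hj)).2
  have hUfacts : ∀ j ∈ U, ψ j < 0 ∧ c j / G j < 0 :=
    fun j hj => puller_facts (a j) (b j) (c j) e k hx (hinc j).1 (hinc j).2 (hUun j hj)
  -- `R` is the complement of `U`
  have hRU : R = Finset.univ.filter (fun j => ¬ 0 < a j * G j) := by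
    rw [hR]
    refine Finset.filter_congr (fun j _ => ⟨fun h => not_lt.mpr h.le, fun h => lt_of_le_of_ne (not_lt.mp h) (hane j)⟩)
  have hsplit : ∀ f : Fin m → ℝ, ∑ j, f j = ∑ j ∈ U, f j + ∑ j ∈ R, f j := by
    intro f
    rw [hU, hRU]
    exact (Finset.sum_filter_add_sum_filter_not _ _ _).symm
  set M := ∑ j ∈ R, ψ j with hM
  have hUsum : ∑ j ∈ U, ψ j = -M := by
    have h := hsplit ψ
    rw [hzero] at h
    linarith
  have hRne : R.Nonempty := by
    by_contra hRe
    rw [Finset.not_nonempty_iff_eq_empty] at hRe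
    have hM0 : M = 0 := by rw [hM, hRe, Finset.sum_empty]
    have hUuniv : U = Finset.univ := by
      rw [hU, Finset.filter_eq_self]
      intro j _
      by_contra hj
      have : j ∈ R := by rw [hRU, mem_filter]; exact ⟨mem_univ _, hj⟩
      rw [hRe] at this; exact absurd this (Finset.notMem_empty _)
    have hneg : ∑ j ∈ U, ψ j < 0 := by
      rw [hUuniv]
      exact Finset.sum_neg (fun j hj => (hUfacts j (hUuniv ▸ hj)).1) ⟨⟨0, hm⟩, mem_univ _⟩
    rw [hUsum, hM0, neg_zero] at hneg
    exact lt_irrefl 0 hneg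
  have hMpos : 0 < M := Finset.sum_pos (fun j hj => (hRfacts j hj).1) hRne
  have hUne : U.Nonempty := by
    by_contra hUe
    rw [Finset.not_nonempty_iff_eq_empty] at hUe
    have : ∑ j ∈ U, ψ j = 0 := by rw [hUe, Finset.sum_empty]
    rw [hUsum] at this
    linarith
  have hρ : (0 : ℝ) < R.card := by exact_mod_cast hRne.card_pos
  have hυ : (0 : ℝ) < U.card := by exact_mod_cast hUne.card_pos
  have hD : (∑ j, ((((e + k + 2 : ℝ) * c j * ((k + 1 : ℝ) * x ^ k)) * (a j + b j * x ^ (e + 1) + c j * x ^ (e + k + 2))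
        - ((e + 1 : ℝ) * b j + (e + k + 2 : ℝ) * c j * x ^ (k + 1))
          * (b j * ((e + 1 : ℝ) * x ^ e) + c j * ((e + k + 2 : ℝ) * x ^ (e + k + 1))))
        / (a j + b j * x ^ (e + 1) + c j * x ^ (e + k + 2)) ^ 2))
      = (e + k + 2 : ℝ) * (k + 1 : ℝ) * x ^ k * (∑ j, c j / G j) - x ^ e * ∑ j, ψ j ^ 2 := by
    rw [Finset.mul_sum, Finset.mul_sum, ← Finset.sum_sub_distrib]
    exact Finset.sum_congr rfl (fun j _ => psi_term_deriv_eq (a j) (b j) (c j) e k (hg j))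
  rw [hD]
  have hA : ∑ j, c j / G j ≤ M / ((e + k + 2 : ℝ) * x ^ (k + 1)) := by
    rw [hsplit (fun j => c j / G j), hM, Finset.sum_div]
    have h1 : ∑ j ∈ U, c j / G j ≤ 0 := Finset.sum_nonpos (fun j hj => (hUfacts j hj).2.le)
    have h2 : ∑ j ∈ R, c j / G j ≤ ∑ j ∈ R, ψ j / ((e + k + 2 : ℝ) * x ^ (k + 1)) :=
      Finset.sum_le_sum (fun j hj => (hRfacts j hj).2.1)
    linarith
  have hSR : M ^ 2 ≤ (R.card : ℝ) * ∑ j ∈ R, ψ j ^ 2 := sq_sum_le_card_mul_sum_sq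
  have hSU : M ^ 2 ≤ (U.card : ℝ) * ∑ j ∈ U, ψ j ^ 2 := by
    have h := sq_sum_le_card_mul_sum_sq (s := U) (f := ψ)
    rw [hUsum, neg_sq] at h
    exact h
  have hS : ∑ j, ψ j ^ 2 = ∑ j ∈ U, ψ j ^ 2 + ∑ j ∈ R, ψ j ^ 2 := hsplit (fun j => ψ j ^ 2)
  -- the mass: `x^{e+1} M > Σ_R μ_j ≥ (k+1)|R||U|/m`
  have hXM : ∑ j ∈ R, μ j < x ^ (e + 1) * M := by
    rw [hM, Finset.mul_sum]
    exact Finset.sum_lt_sum_of_nonempty hRne (fun j hj => hRmass j hj)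
  have hcardm : (U.card : ℝ) + R.card = m := by
    have h := Finset.card_filter_add_card_filter_not (s := (Finset.univ : Finset (Fin m))) (fun j => 0 < a j * G j)
    rw [Finset.card_univ, Fintype.card_fin] at h
    rw [hU, hRU]
    exact_mod_cast h
  have hmass' : ((k : ℝ) + 1) * R.card * U.card ≤ (m : ℝ) * ∑ j ∈ R, μ j := hmass
  have hxk1 : x ^ k * x = x ^ (k + 1) := by rw [pow_succ]
  have hxe1 : x ^ e * x = x ^ (e + 1) := by rw [pow_succ]
  have hstepA : x * ((e + k + 2 : ℝ) * (k + 1 : ℝ) * x ^ k * (∑ j, c j / G j)) ≤ (k + 1 : ℝ) * M := by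
    have h1 : x * ((e + k + 2 : ℝ) * (k + 1 : ℝ) * x ^ k * (∑ j, c j / G j))
        ≤ x * ((e + k + 2 : ℝ) * (k + 1 : ℝ) * x ^ k * (M / ((e + k + 2 : ℝ) * x ^ (k + 1)))) :=
      mul_le_mul_of_nonneg_left (mul_le_mul_of_nonneg_left hA (by positivity)) hx.le
    have h2 : x * ((e + k + 2 : ℝ) * (k + 1 : ℝ) * x ^ k * (M / ((e + k + 2 : ℝ) * x ^ (k + 1)))) = (k + 1 : ℝ) * M := by
      rw [← hxk1]
      field_simp
    linarith
  set S := ∑ j, ψ j ^ 2 with hSdef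
  have hb1 : (U.card : ℝ) * M ^ 2 + R.card * M ^ 2 ≤ (R.card : ℝ) * U.card * S := by
    have e1 : (R.card : ℝ) * U.card * S = U.card * (R.card * ∑ j ∈ R, ψ j ^ 2) + R.card * (U.card * ∑ j ∈ U, ψ j ^ 2) := by
      rw [hS]; ring
    rw [e1]
    exact add_le_add (mul_le_mul_of_nonneg_left hSR hυ.le) (mul_le_mul_of_nonneg_left hSU hρ.le)
  have hm' : (0 : ℝ) < m := by exact_mod_cast hm
  -- `(k+1) ρ υ M ≤ m (Σ_R μ) M < m x^{e+1} M M = x^{e+1} (υ M² + ρ M²)·… ≤ x^{e+1} ρ υ S`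
  have h6 : (m : ℝ) * (∑ j ∈ R, μ j) * M < (m : ℝ) * (x ^ (e + 1) * M) * M :=
    mul_lt_mul_of_pos_right (mul_lt_mul_of_pos_left hXM hm') hMpos
  have h7 : (((k : ℝ) + 1) * R.card * U.card) * M ≤ ((m : ℝ) * ∑ j ∈ R, μ j) * M :=
    mul_le_mul_of_nonneg_right hmass' hMpos.le
  have h4 : x ^ (e + 1) * ((U.card : ℝ) * M ^ 2 + R.card * M ^ 2) ≤ x ^ (e + 1) * ((R.card : ℝ) * U.card * S) :=
    mul_le_mul_of_nonneg_left hb1 hX.le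
  have h5 : (m : ℝ) * (x ^ (e + 1) * M) * M = x ^ (e + 1) * ((U.card : ℝ) * M ^ 2 + R.card * M ^ 2) := by
    rw [← hcardm]; ring
  have h8 : (R.card : ℝ) * U.card * ((k + 1 : ℝ) * M) < (R.card : ℝ) * U.card * (x ^ (e + 1) * S) := by
    have e7 : (((k : ℝ) + 1) * R.card * U.card) * M = (R.card : ℝ) * U.card * ((k + 1 : ℝ) * M) := by ring
    have e8 : x ^ (e + 1) * ((R.card : ℝ) * U.card * S) = (R.card : ℝ) * U.card * (x ^ (e + 1) * S) := by ring
    linarith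
  have hstepB : (k + 1 : ℝ) * M < x ^ (e + 1) * S := lt_of_mul_lt_mul_left h8 (mul_nonneg hρ.le hυ.le)
  have hfin : x * ((e + k + 2 : ℝ) * (k + 1 : ℝ) * x ^ k * (∑ j, c j / G j) - x ^ e * S) < 0 := by
    have e3 : x * ((e + k + 2 : ℝ) * (k + 1 : ℝ) * x ^ k * (∑ j, c j / G j) - x ^ e * S)
        = x * ((e + k + 2 : ℝ) * (k + 1 : ℝ) * x ^ k * (∑ j, c j / G j)) - x ^ (e + 1) * S := by
      rw [← hxe1]; ring
    rw [e3]
    linarith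
  by_contra hcon
  push Not at hcon
  exact absurd hfin (not_lt.mpr (mul_nonneg hx.le hcon))

/-! ### §3 The window law -/

/-- ★★ **RISER-MASS WINDOW LAW (normalised chart).**  Pure incoherent company, `m ≥ 1`; on `[w₁,w₂] ⊂ (0,∞)` no row vanishes and at every point
the riser-mass inequality `(k+1)·|R|·|U| ≤ m·Σ_R μ_j` holds.  Then `X·P′` has no two zeros `w₁, w₂`. [this file's theorem] -/
theorem X_mul_derivative_no_two_zeros_of_riserMass {m : ℕ} (hm : 0 < m) (a b c : Fin m → ℝ) (e k : ℕ) {w₁ w₂ : ℝ}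
    (hw₁ : 0 < w₁) (hw : w₁ < w₂)
    (hinc : ∀ j, a j * b j < 0 ∧ a j * c j < 0)
    (hfree : ∀ t ∈ Set.Icc w₁ w₂, ∀ j, a j + b j * t ^ (e + 1) + c j * t ^ (e + k + 2) ≠ 0)
    (hmass : ∀ t ∈ Set.Icc w₁ w₂, ((k : ℝ) + 1)
        * ((Finset.univ.filter (fun j => a j * (a j + b j * t ^ (e + 1) + c j * t ^ (e + k + 2)) < 0)).card : ℝ)
        * ((Finset.univ.filter (fun j => 0 < a j * (a j + b j * t ^ (e + 1) + c j * t ^ (e + k + 2)))).card : ℝ)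
      ≤ (m : ℝ) * ∑ j ∈ Finset.univ.filter (fun j => a j * (a j + b j * t ^ (e + 1) + c j * t ^ (e + k + 2)) < 0),
          ((e + 1 : ℝ) * b j + (e + k + 2 : ℝ) * c j * t ^ (k + 1)) / (b j + c j * t ^ (k + 1)))
    (h1 : eval w₁ (X * derivative (∏ j, (C (a j) + C (b j) * X ^ (e + 1) + C (c j) * X ^ (e + k + 2)))) = 0)
    (h2 : eval w₂ (X * derivative (∏ j, (C (a j) + C (b j) * X ^ (e + 1) + C (c j) * X ^ (e + k + 2)))) = 0) : False := by
  set φ : ℝ → ℝ := fun y => ∑ j, ((e + 1 : ℝ) * b j + (e + k + 2 : ℝ) * c j * y ^ (k + 1))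
      / (a j + b j * y ^ (e + 1) + c j * y ^ (e + k + 2)) with hφ
  set φ' : ℝ → ℝ := fun t => ∑ j, ((((e + k + 2 : ℝ) * c j * ((k + 1 : ℝ) * t ^ k)) * (a j + b j * t ^ (e + 1) + c j * t ^ (e + k + 2))
        - ((e + 1 : ℝ) * b j + (e + k + 2 : ℝ) * c j * t ^ (k + 1))
          * (b j * ((e + 1 : ℝ) * t ^ e) + c j * ((e + k + 2 : ℝ) * t ^ (e + k + 1))))
        / (a j + b j * t ^ (e + 1) + c j * t ^ (e + k + 2)) ^ 2) with hφ'
  have hder : ∀ t ∈ Set.Icc w₁ w₂, HasDerivAt φ (φ' t) t := by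
    intro t ht
    have := HasDerivAt.fun_sum (u := Finset.univ) (fun j _ => hasDerivAt_term (a j) (b j) (c j) e k (hfree t ht j))
    rw [hφ]
    exact this
  have hdown : ∀ t ∈ Set.Icc w₁ w₂, φ t = 0 → φ' t < 0 := by
    intro t ht h0
    exact psi_deriv_neg_at_zero_of_riserMass hm a b c e k (hw₁.trans_le ht.1) (hfree t ht) hinc (hmass t ht) h0
  have h01 : φ w₁ = 0 := psi_eq_zero_of_eval_X_mul_derivative a b c e k hw₁ (hfree w₁ ⟨le_rfl, hw.le⟩) h1
  have h02 : φ w₂ = 0 := psi_eq_zero_of_eval_X_mul_derivative a b c e k (hw₁.trans hw) (hfree w₂ ⟨hw.le, le_rfl⟩) h2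
  exact no_two_zeros_of_deriv_neg_at_zeros hder hdown le_rfl hw le_rfl h01 h02

/-- ★★ **RISER-MASS WINDOW LAW** (`K = 3`, bottom coupling, ANY support `d 0 < d 1 < d 2`, any `m`; pure incoherent company
`a_{j0}a_{j1} < 0`, `a_{j0}a_{j2} < 0`).  On a zero-free window `[u,v] ⊂ (0,∞)` on which at every point `t`, with `R(t)`/`U(t)` the switched
(`a_{j0}·f_j(t) < 0`) / unswitched (`a_{j0}·f_j(t) > 0`) rows and `μ_j(t) = ((d₁−d₀)a_{j1} + (d₂−d₀)a_{j2}t^{d₂−d₁})/(a_{j1} + a_{j2}t^{d₂−d₁})`,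
`(d₂−d₁)·|R(t)|·|U(t)| ≤ m·Σ_{R(t)} μ_j(t)`, the c-free Euler numerator `eulerNumerator d a 0` has AT MOST ONE root. [this file's theorem] -/
theorem euler_window_roots_le_one_of_riserMass {m : ℕ} (d : Fin 3 → ℕ) (h01 : d 0 < d 1) (h12 : d 1 < d 2)
    (a : Fin m → Fin 3 → ℝ) (hinc : ∀ j, a j 0 * a j 1 < 0 ∧ a j 0 * a j 2 < 0) {u v : ℝ} (hu : 0 < u)
    (hfree : ∀ t ∈ Set.Icc u v, ∀ j, (∑ l, C (a j l) * X ^ (d l) : ℝ[X]).eval t ≠ 0)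
    (hmass : ∀ t ∈ Set.Icc u v, ((d 2 : ℝ) - d 1)
        * ((Finset.univ.filter (fun j => a j 0 * (∑ l, C (a j l) * X ^ (d l) : ℝ[X]).eval t < 0)).card : ℝ)
        * ((Finset.univ.filter (fun j => 0 < a j 0 * (∑ l, C (a j l) * X ^ (d l) : ℝ[X]).eval t)).card : ℝ)
      ≤ (m : ℝ) * ∑ j ∈ Finset.univ.filter (fun j => a j 0 * (∑ l, C (a j l) * X ^ (d l) : ℝ[X]).eval t < 0),
          (((d 1 : ℝ) - d 0) * a j 1 + ((d 2 : ℝ) - d 0) * a j 2 * t ^ (d 2 - d 1)) / (a j 1 + a j 2 * t ^ (d 2 - d 1))) :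
    ((∑ j, (∑ l, C (a j l * ((d l : ℝ) - d 0)) * X ^ (d l)) * ∏ i ∈ Finset.univ.erase j, (∑ l, C (a i l) * X ^ (d l))
        : ℝ[X]).roots.toFinset.filter (fun t => u ≤ t ∧ t ≤ v)).card ≤ 1 := by
  classical
  rcases Nat.eq_zero_or_pos m with hm | hm
  · subst hm
    simp only [Finset.univ_eq_empty, Finset.sum_empty, roots_zero, Multiset.toFinset_zero, Finset.filter_empty,
      Finset.card_empty]
    exact Nat.zero_le _
  obtain ⟨e, he⟩ : ∃ e, d 1 = d 0 + e + 1 := ⟨d 1 - d 0 - 1, by omega⟩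
  obtain ⟨k, hk⟩ : ∃ k, d 2 = d 0 + e + k + 2 := ⟨d 2 - d 1 - 1, by omega⟩
  have hk1 : d 2 - d 1 = k + 1 := by omega
  have hp : ((d 1 : ℝ) - d 0) = (e + 1 : ℝ) := by rw [he]; push_cast; ring
  have hq : ((d 2 : ℝ) - d 0) = (e + k + 2 : ℝ) := by rw [hk]; push_cast; ring
  have hqp : ((d 2 : ℝ) - d 1) = (k + 1 : ℝ) := by rw [hk, he]; push_cast; ring
  rw [eulerNumerator_eq d e k he hk a 0, sub_self, mul_zero, map_zero, zero_mul, sub_zero]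
  set E : ℝ[X] := X * derivative (∏ j, (C (a j 0) + C (a j 1) * X ^ (e + 1) + C (a j 2) * X ^ (e + k + 2))) with hE
  by_contra hgt
  push Not at hgt
  obtain ⟨z₁, hz₁, z₂, hz₂, hne⟩ := Finset.one_lt_card.mp hgt
  have hfree' : ∀ w₁ w₂ : ℝ, u ≤ w₁ → w₂ ≤ v → ∀ t ∈ Set.Icc w₁ w₂, ∀ j,
      a j 0 + a j 1 * t ^ (e + 1) + a j 2 * t ^ (e + k + 2) ≠ 0 := by
    intro w₁ w₂ hw₁ hw₂ t ht j
    have h := hfree t ⟨hw₁.trans ht.1, ht.2.trans hw₂⟩ j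
    rw [eval_row_eq_pow_mul d e k he hk (a j) t] at h
    exact right_ne_zero_of_mul h
  have hmass' : ∀ w₁ w₂ : ℝ, u ≤ w₁ → w₂ ≤ v → ∀ t ∈ Set.Icc w₁ w₂, ((k : ℝ) + 1)
        * ((Finset.univ.filter (fun j => a j 0 * (a j 0 + a j 1 * t ^ (e + 1) + a j 2 * t ^ (e + k + 2)) < 0)).card : ℝ)
        * ((Finset.univ.filter (fun j => 0 < a j 0 * (a j 0 + a j 1 * t ^ (e + 1) + a j 2 * t ^ (e + k + 2)))).card : ℝ)
      ≤ (m : ℝ) * ∑ j ∈ Finset.univ.filter (fun j => a j 0 * (a j 0 + a j 1 * t ^ (e + 1) + a j 2 * t ^ (e + k + 2)) < 0),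
          ((e + 1 : ℝ) * a j 1 + (e + k + 2 : ℝ) * a j 2 * t ^ (k + 1)) / (a j 1 + a j 2 * t ^ (k + 1)) := by
    intro w₁ w₂ hw₁ hw₂ t ht
    have htI : t ∈ Set.Icc u v := ⟨hw₁.trans ht.1, ht.2.trans hw₂⟩
    have ht0 : 0 < t := hu.trans_le htI.1
    have h := hmass t htI
    have hsetR : Finset.univ.filter (fun j => a j 0 * (∑ l, C (a j l) * X ^ (d l) : ℝ[X]).eval t < 0)
        = Finset.univ.filter (fun j => a j 0 * (a j 0 + a j 1 * t ^ (e + 1) + a j 2 * t ^ (e + k + 2)) < 0) := by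
      refine Finset.filter_congr (fun j _ => ?_)
      rw [eval_row_eq_pow_mul d e k he hk (a j) t, mul_left_comm]
      exact ⟨fun h' => neg_of_mul_neg_right h' (pow_pos ht0 _).le, fun h' => mul_neg_of_pos_of_neg (pow_pos ht0 _) h'⟩
    have hsetU : Finset.univ.filter (fun j => 0 < a j 0 * (∑ l, C (a j l) * X ^ (d l) : ℝ[X]).eval t)
        = Finset.univ.filter (fun j => 0 < a j 0 * (a j 0 + a j 1 * t ^ (e + 1) + a j 2 * t ^ (e + k + 2))) := by
      refine Finset.filter_congr (fun j _ => ?_)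
      rw [eval_row_eq_pow_mul d e k he hk (a j) t, mul_left_comm]
      exact ⟨fun h' => pos_of_mul_pos_right h' (pow_pos ht0 _).le, fun h' => mul_pos (pow_pos ht0 _) h'⟩
    rw [hsetR, hsetU, hp, hq, hqp, hk1] at h
    exact h
  have hmem : ∀ z ∈ (((X : ℝ[X]) ^ (m * d 0) * E).roots.toFinset.filter (fun t => u ≤ t ∧ t ≤ v)),
      u ≤ z ∧ z ≤ v ∧ eval z E = 0 := by
    intro z hz
    rw [mem_filter, Multiset.mem_toFinset] at hz
    by_cases h0 : (X : ℝ[X]) ^ (m * d 0) * E = 0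
    · rw [h0, roots_zero] at hz
      exact absurd hz.1 (Multiset.notMem_zero _)
    · have hr := (mem_roots h0).mp hz.1
      rw [IsRoot.def, eval_mul, eval_pow, eval_X] at hr
      refine ⟨hz.2.1, hz.2.2, ?_⟩
      rcases mul_eq_zero.mp hr with h | h
      · exact absurd h (pow_ne_zero _ (hu.trans_le hz.2.1).ne')
      · exact h
  have hinc' : ∀ j, a j 0 * a j 1 < 0 ∧ a j 0 * a j 2 < 0 := hinc
  obtain ⟨hu₁, hv₁, hE₁⟩ := hmem z₁ hz₁
  obtain ⟨hu₂, hv₂, hE₂⟩ := hmem z₂ hz₂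
  rcases lt_or_gt_of_ne hne with hlt | hlt
  · exact X_mul_derivative_no_two_zeros_of_riserMass hm (fun j => a j 0) (fun j => a j 1) (fun j => a j 2) e k
      (hu.trans_le hu₁) hlt hinc' (hfree' z₁ z₂ hu₁ hv₂) (hmass' z₁ z₂ hu₁ hv₂) hE₁ hE₂
  · exact X_mul_derivative_no_two_zeros_of_riserMass hm (fun j => a j 0) (fun j => a j 1) (fun j => a j 2) e k
      (hu.trans_le hu₂) hlt hinc' (hfree' z₂ z₁ hu₂ hv₁) (hmass' z₂ z₁ hu₂ hv₁) hE₂ hE₁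

end ProductPlusOne

end Summit.ValiantsHypothesis.ValiantsHypothesis.Theorems.LacunarySymmetroidMatrixDescartes
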